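import Literature.NumberTheory.Weil1964.UnitaryArchLocalTopFormHaar     -- ★ p844350 A-p06 (g28) U1 FILE B: `skewC`, `skewMulLC`, `cayleyWeightC`, `lieFinBasisC`, `finiteDimensional_matrixC`
import Mathlib.LinearAlgebra.Matrix.Vec
import Mathlib.LinearAlgebra.Matrix.Kronecker
import HarnessLib

/-!
# (U) ROAD, U4-DISCHARGE brick (b3)-(i): THE CAYLEY WEIGHT OF `U(Jw)` IN CLOSED FORM — `w₀(Y) = ‖det(1 + Y)‖^{−2N}` on `𝔲(Jw)`, for every hermitian invertible `Jw`
# (Weyl, *Classical Groups* II §10; Knapp, *Lie Groups Beyond an Introduction* I §1, VIII §2; Rogawski 1990 §1.7 p. 6 «`dg = |Ω|_v`»)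

Topic `NumberTheory/Weil1964`; namespace `Literature.NumberTheory.Weil1964.UnitaryArchLocalTopForm`.  THEOREMS ONLY (no definition — the `vec` linear equivalence and the complex basis
`Module.Basis.mk …` carried by a real basis of `𝔲(Jw)` are built inline; no instance, no notation, no named fact, no `sorry`); kernel lane.
Cell `pub/hodgecm-mathlib` (D-0151), crux H413 = `stmt-HodgeConjecture-24833` (supports only); ROAD (U), the U4-DISCHARGE package (LEAD F0P3a-plan (g10) WORD T9-40 (d1): (b2) p07,
(b3) A-p12 (g20), (cpt-transport) F0P3-p03 (g11); owner A-p19 (g24); CENSUS-Jval cbbd319c §1; A-p12 census 13:25Z).  THIS FILE is piece (i) of (b3): the Jacobian weight `w₀` of ★ U1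
`localTopFormHaar N Jw := (ν_W ∕ haar(ĉ W)) • haar`, `ν_W = ĉ_*(w₀ · lieStdLebesgueC|_W)`, in CLOSED FORM — the common input of the three U4-discharge hands (the masses
`vol^TF(U(2))`, `vol^TF(U(1))`, the (J-nc) constant, and the congruence transport all integrate `w₀`).  OFF the closing path of (U) (T9-40); pays no letter by itself.
HONEST LABEL: HC_CM is proved only modulo the cell's 2 remaining named inputs (hLiu418 24832, h413 24833) until rung 0 closes.

THE MATHEMATICS.  `𝔲 = 𝔲(Jw) = {X ∈ M_N(ℂ) | Xᴴ Jw + Jw X = 0}` (★ `skewC`), `m_Y(H) = (1 − Y) H (1 + Y)` (★ `skewMulLC`), `w₀(Y) = |det_ℝ m_Y|_𝔲|⁻¹` (★ `cayleyWeightC`).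
§1 On `M_n(R)` the map `X ↦ A X B` is, in `vec` coordinates, the Kronecker matrix `Bᵀ ⊗ A` (Mathlib `Matrix.kronecker_mulVec_vec`), hence **`det (X ↦ A X B) = (det A)ⁿ (det B)ⁿ`**
(`det_mulLeftRight`, Mathlib `Matrix.det_kronecker`).  §2 For `Jw` HERMITIAN and INVERTIBLE, `𝔲(Jw)` is a REAL FORM of `M_N(ℂ)`: `𝔲 ∩ i𝔲 = 0` (`eq_zero_of_I_smul_mem_skewC`) and
`X = ½(X − Jw⁻¹XᴴJw) + i·(−i∕2)(X + Jw⁻¹XᴴJw)` with both parts in `𝔲` (`half_sub_conj_mem_skewC`, `negI_half_add_conj_mem_skewC`, `eq_half_sub_add_I_smul`); so every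
real basis `b` of `𝔲` is a complex basis `Module.Basis.mk …` of `M_N(ℂ)` (`linearIndependent_coe_basis`, `span_coe_basis_eq_top`) with the SAME coordinates on `𝔲` (`basis_mk_coe_repr_coe`).
§3 Therefore the real matrix of `m_Y|_𝔲` in `b` is the complex matrix of `L_{1−Y} ∘ R_{1+Y}` in that basis: **`det_ℝ(m_Y|_𝔲) = det_ℂ(L_{1−Y} R_{1+Y}) = det(1−Y)ᴺ det(1+Y)ᴺ`**
(`det_skewMulLC_eq_det_mulLeftRight` + §1); for `Y ∈ 𝔲`, `1 − Y = Jw⁻¹ (1 + Y)ᴴ Jw` gives `det(1 − Y) = conj det(1 + Y)` (`det_one_sub_eq_conj_det_one_add`), so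
**`det_ℝ(m_Y|_𝔲) = ‖det(1 + Y)‖^{2N}`** (`det_skewMulLC_eq`) and **`w₀(Y) = ‖det(1 + Y)‖^{−2N}`** (`cayleyWeightC_eq`).  (For `N = 1`: `w₀(it) = (1 + t²)⁻¹`; for `N = 2`,
`Y = (ia, z; −z̄, ib)`: `w₀ = ((1 − ab + |z|²)² + (a + b)²)⁻²` — the integrands of (b3)-(iii).)

## References
* [Weyl1939] H. Weyl, *The Classical Groups* (1939), Ch. II §10 (the Cayley parametrisation of the orthogonal ∕ unitary groups).
* [Knapp2002] A. W. Knapp, *Lie Groups Beyond an Introduction*, 2nd ed. (2002), I §1 (real forms `𝔤 = 𝔤₀ ⊕ i𝔤₀`), VIII §2 (determinants, Lebesgue measure from a basis).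
* [Rogawski1990] J. D. Rogawski, *Automorphic Representations of Unitary Groups in Three Variables* (1990), §1.7 p. 6 (`dg = |Ω|_v`).
-/

set_option autoImplicit false
set_option backward.isDefEq.respectTransparency false

noncomputable section

open Set NumberField Module Matrix
open scoped Classical Matrix Matrix.Norms.Operator MatrixGroups Kronecker ComplexConjugate

namespace Literature.NumberTheory.Weil1964

namespace UnitaryArchLocalTopForm

/-! ## §1 The determinant of `X ↦ A X B` on `M_n(R)` -/

section MulLeftRight

variable {R : Type*} [CommRing R] {n : Type*} [Fintype n] [DecidableEq n]

/-- **`det (X ↦ A X B) = (det A)ⁿ (det B)ⁿ` on `M_n(R)`**: in `vec` coordinates (Mathlib `Matrix.vec`, packaged locally as a linear equivalence) the map is the Kronecker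
matrix `Bᵀ ⊗ A` (`Matrix.kronecker_mulVec_vec`), whose determinant is `det(Bᵀ)ⁿ det(A)ⁿ` (`Matrix.det_kronecker`). [cite: Knapp2002, VIII §2] -/
theorem det_mulLeftRight (A B : Matrix n n R) :
    LinearMap.det (LinearMap.mulLeftRight R (A, B)) = A.det ^ Fintype.card n * B.det ^ Fintype.card n := by
  -- `vec` as a linear equivalence
  let e : Matrix n n R ≃ₗ[R] (n × n → R) :=
    { toFun := Matrix.vec
      map_add' := Matrix.vec_add
      map_smul' := fun r X => Matrix.vec_smul r X
      invFun := fun v => Matrix.of fun i j => v (j, i)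
      left_inv := fun X => by ext i j; rfl
      right_inv := fun v => by funext ⟨j, i⟩; rfl }
  have he : ∀ X, e X = Matrix.vec X := fun _ => rfl
  have hconj : e.conj (LinearMap.mulLeftRight R (A, B)) = Matrix.toLin' (Bᵀ ⊗ₖ A) := by
    refine LinearMap.ext fun v => ?_
    obtain ⟨X, rfl⟩ := e.surjective v
    rw [LinearEquiv.conj_apply_apply, LinearEquiv.symm_apply_apply, Matrix.toLin'_apply, he, he, Matrix.kronecker_mulVec_vec, Matrix.transpose_transpose]
    rfl
  have h := congrArg LinearMap.det hconj
  rw [LinearEquiv.conj_apply, LinearMap.comp_assoc, LinearMap.det_conj, LinearMap.det_toLin', Matrix.det_kronecker, Matrix.det_transpose] at h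
  rw [h, mul_comm]

end MulLeftRight

/-! ## §2 `𝔲(Jw)` is a real form of `M_N(ℂ)`: a real basis of `𝔲(Jw)` is a complex basis of `M_N(ℂ)` (for `Jw` hermitian invertible) -/

section RealForm

variable {N : ℕ} {Jw : Matrix (Fin N) (Fin N) ℂ}

/-- If `Q ∈ 𝔲(Jw)` and `I • Q ∈ 𝔲(Jw)` then `Q = 0` (`Jw` invertible): `𝔲 ∩ i𝔲 = 0`. [cite: Knapp2002, I §1] -/
theorem eq_zero_of_I_smul_mem_skewC (hJ : IsUnit Jw.det) {Q : Matrix (Fin N) (Fin N) ℂ} (hQ : Q ∈ skewC N Jw) (hIQ : Complex.I • Q ∈ skewC N Jw) : Q = 0 := by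
  rw [mem_skewC_iff] at hQ hIQ
  rw [Matrix.conjTranspose_smul, Complex.star_def, Complex.conj_I, Matrix.smul_mul, Matrix.mul_smul, neg_smul] at hIQ
  -- `hIQ : -(I • QᴴJ) + I • JQ = 0`, `hQ : QᴴJ + JQ = 0` ⇒ `JQ = 0`
  have hQJ : Qᴴ * Jw = -(Jw * Q) := eq_neg_of_add_eq_zero_left hQ
  rw [hQJ, smul_neg, neg_neg, ← smul_add, smul_eq_zero] at hIQ
  rcases hIQ with hI | h2
  · exact absurd hI Complex.I_ne_zero
  · have hJQ : Jw * Q = 0 := by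
      have h2' : (2 : ℂ) • (Jw * Q) = 0 := by rw [two_smul]; exact h2
      exact (smul_eq_zero.1 h2').resolve_left two_ne_zero
    calc Q = Jw⁻¹ * (Jw * Q) := by rw [← Matrix.mul_assoc, Matrix.nonsing_inv_mul _ hJ, Matrix.one_mul]
      _ = 0 := by rw [hJQ, Matrix.mul_zero]

/-- The `𝔲`-part `½ (X − Jw⁻¹ Xᴴ Jw)` of `X` lies in `𝔲(Jw)` (`Jw` hermitian invertible). [cite: Knapp2002, I §1] -/
theorem half_sub_conj_mem_skewC (hherm : Jwᴴ = Jw) (hJ : IsUnit Jw.det) (X : Matrix (Fin N) (Fin N) ℂ) :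
    (2⁻¹ : ℂ) • (X - Jw⁻¹ * Xᴴ * Jw) ∈ skewC N Jw := by
  rw [mem_skewC_iff, Matrix.conjTranspose_smul, Matrix.smul_mul, Matrix.mul_smul]
  have hs : (star (2⁻¹ : ℂ)) = 2⁻¹ := by rw [Complex.star_def, map_inv₀, map_ofNat]
  rw [hs, ← smul_add, Matrix.conjTranspose_sub, Matrix.conjTranspose_mul, Matrix.conjTranspose_mul, Matrix.conjTranspose_conjTranspose,
    Matrix.conjTranspose_nonsing_inv, hherm]
  have h1 : (Xᴴ - Jw * (X * Jw⁻¹)) * Jw + Jw * (X - Jw⁻¹ * Xᴴ * Jw) = 0 := by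
    rw [Matrix.sub_mul, Matrix.mul_sub, Matrix.mul_assoc Jw, Matrix.mul_assoc X, Matrix.nonsing_inv_mul _ hJ, Matrix.mul_one, ← Matrix.mul_assoc Jw,
      ← Matrix.mul_assoc Jw, Matrix.mul_nonsing_inv _ hJ, Matrix.one_mul]
    abel
  rw [h1, smul_zero]

/-- The `i𝔲`-part: `(−I∕2) (X + Jw⁻¹ Xᴴ Jw)` lies in `𝔲(Jw)` (`Jw` hermitian invertible). [cite: Knapp2002, I §1] -/
theorem negI_half_add_conj_mem_skewC (hherm : Jwᴴ = Jw) (hJ : IsUnit Jw.det) (X : Matrix (Fin N) (Fin N) ℂ) :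
    (-(Complex.I * 2⁻¹) : ℂ) • (X + Jw⁻¹ * Xᴴ * Jw) ∈ skewC N Jw := by
  rw [mem_skewC_iff, Matrix.conjTranspose_smul, Matrix.smul_mul, Matrix.mul_smul, Matrix.conjTranspose_add, Matrix.conjTranspose_mul,
    Matrix.conjTranspose_mul, Matrix.conjTranspose_conjTranspose, Matrix.conjTranspose_nonsing_inv, hherm]
  have hs : (star (-(Complex.I * 2⁻¹) : ℂ)) = Complex.I * 2⁻¹ := by
    rw [Complex.star_def, map_neg, map_mul, Complex.conj_I, map_inv₀, map_ofNat]; ring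
  rw [hs]
  have h1 : (Xᴴ + Jw * (X * Jw⁻¹)) * Jw = Jw * (X + Jw⁻¹ * Xᴴ * Jw) := by
    rw [Matrix.add_mul, Matrix.mul_add, Matrix.mul_assoc Jw, Matrix.mul_assoc X, Matrix.nonsing_inv_mul _ hJ, Matrix.mul_one, ← Matrix.mul_assoc Jw,
      ← Matrix.mul_assoc Jw, Matrix.mul_nonsing_inv _ hJ, Matrix.one_mul, add_comm]
  rw [h1, ← add_smul]
  have h0 : Complex.I * 2⁻¹ + -(Complex.I * 2⁻¹) = 0 := by ring
  rw [h0, zero_smul]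

/-- The decomposition `X = ½ (X − Jw⁻¹XᴴJw) + I • ((−I∕2)(X + Jw⁻¹XᴴJw))`. [cite: Knapp2002, I §1] -/
theorem eq_half_sub_add_I_smul (X : Matrix (Fin N) (Fin N) ℂ) :
    X = (2⁻¹ : ℂ) • (X - Jw⁻¹ * Xᴴ * Jw) + Complex.I • ((-(Complex.I * 2⁻¹) : ℂ) • (X + Jw⁻¹ * Xᴴ * Jw)) := by
  rw [smul_smul, smul_sub, smul_add]
  have hI : Complex.I * -(Complex.I * 2⁻¹) = 2⁻¹ := by rw [mul_neg, ← mul_assoc, Complex.I_mul_I]; ring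
  rw [hI]
  module

/-- The real coordinates of an element of `𝔲(Jw)` in a real basis, read in `M_N(ℂ)`. [cite: Knapp2002, I §1] -/
theorem coe_eq_sum_repr_smul {ι : Type} [Fintype ι] (b : Module.Basis ι ℝ (skewC N Jw)) (P : skewC N Jw) :
    (P : Matrix (Fin N) (Fin N) ℂ) = ∑ i, ((b.repr P i : ℝ) : ℂ) • ((b i : skewC N Jw) : Matrix (Fin N) (Fin N) ℂ) := by
  conv_lhs => rw [← b.sum_repr P]
  rw [Submodule.coe_sum]
  refine Finset.sum_congr rfl fun i _ => ?_
  rw [Submodule.coe_smul, Complex.coe_smul]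

/-- **A real basis of `𝔲(Jw)` is `ℂ`-linearly independent in `M_N(ℂ)`** (`Jw` invertible). [cite: Knapp2002, I §1] -/
theorem linearIndependent_coe_basis (hJ : IsUnit Jw.det) {ι : Type} [Fintype ι] (b : Module.Basis ι ℝ (skewC N Jw)) :
    LinearIndependent ℂ (fun i => ((b i : skewC N Jw) : Matrix (Fin N) (Fin N) ℂ)) := by
  rw [Fintype.linearIndependent_iff]
  intro g hg
  -- split `g = x + y I`
  set P : skewC N Jw := ∑ i, (g i).re • b i with hP
  set Q : skewC N Jw := ∑ i, (g i).im • b i with hQ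
  have hPc : (P : Matrix (Fin N) (Fin N) ℂ) = ∑ i, ((g i).re : ℂ) • ((b i : skewC N Jw) : Matrix (Fin N) (Fin N) ℂ) := by
    rw [hP, Submodule.coe_sum]; exact Finset.sum_congr rfl fun i _ => by rw [Submodule.coe_smul, Complex.coe_smul]
  have hQc : (Q : Matrix (Fin N) (Fin N) ℂ) = ∑ i, ((g i).im : ℂ) • ((b i : skewC N Jw) : Matrix (Fin N) (Fin N) ℂ) := by
    rw [hQ, Submodule.coe_sum]; exact Finset.sum_congr rfl fun i _ => by rw [Submodule.coe_smul, Complex.coe_smul]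
  have hsum : (P : Matrix (Fin N) (Fin N) ℂ) + Complex.I • (Q : Matrix (Fin N) (Fin N) ℂ) = 0 := by
    rw [hPc, hQc, Finset.smul_sum, ← Finset.sum_add_distrib, ← hg]
    refine Finset.sum_congr rfl fun i _ => ?_
    rw [smul_smul, ← add_smul]
    congr 1
    rw [mul_comm]; exact (Complex.re_add_im (g i))
  -- `I • Q = -P ∈ 𝔲` ⇒ `Q = 0` ⇒ `P = 0`
  have hIQmem : Complex.I • (Q : Matrix (Fin N) (Fin N) ℂ) ∈ skewC N Jw := by
    have h : Complex.I • (Q : Matrix (Fin N) (Fin N) ℂ) = -(P : Matrix (Fin N) (Fin N) ℂ) := eq_neg_of_add_eq_zero_right hsum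
    rw [h]; exact (skewC N Jw).neg_mem P.2
  have hQ0 : (Q : Matrix (Fin N) (Fin N) ℂ) = 0 := eq_zero_of_I_smul_mem_skewC hJ Q.2 hIQmem
  have hP0 : (P : Matrix (Fin N) (Fin N) ℂ) = 0 := by rw [← hsum, hQ0, smul_zero, add_zero]
  have hQ0' : Q = 0 := Subtype.ext hQ0
  have hP0' : P = 0 := Subtype.ext hP0
  have hli := Fintype.linearIndependent_iff.1 b.linearIndependent
  intro i
  apply Complex.ext
  · rw [Complex.zero_re]; exact hli (fun i => (g i).re) (by rw [← hP]; exact hP0') i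
  · rw [Complex.zero_im]; exact hli (fun i => (g i).im) (by rw [← hQ]; exact hQ0') i

/-- **… and spans `M_N(ℂ)` over `ℂ`** (`Jw` hermitian invertible): `M_N(ℂ) = 𝔲 ⊕ i𝔲`. [cite: Knapp2002, I §1] -/
theorem span_coe_basis_eq_top (hherm : Jwᴴ = Jw) (hJ : IsUnit Jw.det) {ι : Type} [Fintype ι] (b : Module.Basis ι ℝ (skewC N Jw)) :
    ⊤ ≤ Submodule.span ℂ (Set.range fun i => ((b i : skewC N Jw) : Matrix (Fin N) (Fin N) ℂ)) := by
  intro X _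
  have hmem : ∀ P : skewC N Jw, (P : Matrix (Fin N) (Fin N) ℂ) ∈ Submodule.span ℂ (Set.range fun i => ((b i : skewC N Jw) : Matrix (Fin N) (Fin N) ℂ)) := by
    intro P
    rw [coe_eq_sum_repr_smul b P]
    exact Submodule.sum_mem _ fun i _ => Submodule.smul_mem _ _ (Submodule.subset_span ⟨i, rfl⟩)
  rw [eq_half_sub_add_I_smul (Jw := Jw) X]
  exact Submodule.add_mem _ (hmem ⟨_, half_sub_conj_mem_skewC hherm hJ X⟩) (Submodule.smul_mem _ _ (hmem ⟨_, negI_half_add_conj_mem_skewC hherm hJ X⟩))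

/-- **THE COMPLEX BASIS OF `M_N(ℂ)` CARRIED BY A REAL BASIS OF `𝔲(Jw)`** (`Module.Basis.mk` on the two facts above) has the basis vectors `↑(b i)`. [cite: Knapp2002, I §1] -/
theorem basis_mk_coe_apply (hherm : Jwᴴ = Jw) (hJ : IsUnit Jw.det) {ι : Type} [Fintype ι] (b : Module.Basis ι ℝ (skewC N Jw)) (i : ι) :
    Module.Basis.mk (linearIndependent_coe_basis hJ b) (span_coe_basis_eq_top hherm hJ b) i = ((b i : skewC N Jw) : Matrix (Fin N) (Fin N) ℂ) := by
  rw [Module.Basis.mk_apply]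

/-- Real coordinates are complex coordinates: the complex basis carried by `b` reads `↑P`, `P ∈ 𝔲`, with the coordinates `b.repr P`. [cite: Knapp2002, I §1] -/
theorem basis_mk_coe_repr_coe (hherm : Jwᴴ = Jw) (hJ : IsUnit Jw.det) {ι : Type} [Fintype ι] (b : Module.Basis ι ℝ (skewC N Jw)) (P : skewC N Jw) (i : ι) :
    (Module.Basis.mk (linearIndependent_coe_basis hJ b) (span_coe_basis_eq_top hherm hJ b)).repr (P : Matrix (Fin N) (Fin N) ℂ) i = ((b.repr P i : ℝ) : ℂ) := by
  have h : (P : Matrix (Fin N) (Fin N) ℂ) = ∑ j, ((b.repr P j : ℝ) : ℂ) • Module.Basis.mk (linearIndependent_coe_basis hJ b) (span_coe_basis_eq_top hherm hJ b) j := by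
    rw [coe_eq_sum_repr_smul b P]; exact Finset.sum_congr rfl fun j _ => by rw [basis_mk_coe_apply hherm hJ]
  rw [h, Module.Basis.repr_sum_self]

end RealForm

/-! ## §3 The Cayley weight in closed form: `w₀(Y) = |det(1 + Y)|^{−2N}` -/

section Weight

variable {N : ℕ} {Jw : Matrix (Fin N) (Fin N) ℂ}

/-- **THE REAL DETERMINANT OF `m_Y|_𝔲` IS THE COMPLEX DETERMINANT OF `m_Y` ON `M_N(ℂ)`**: in the complex basis carried by a real basis of `𝔲`, `m_Y = L_{1−Y} R_{1+Y}` has a real matrix.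
[cite: Knapp2002, I §1; VIII §2] -/
theorem det_skewMulLC_eq_det_mulLeftRight (hherm : Jwᴴ = Jw) (hJ : IsUnit Jw.det) (Y : skewC N Jw) :
    ((LinearMap.det (skewMulLC N Jw Y : skewC N Jw →ₗ[ℝ] skewC N Jw) : ℝ) : ℂ) =
      LinearMap.det (LinearMap.mulLeftRight ℂ ((1 - (Y : Matrix (Fin N) (Fin N) ℂ)), (1 + (Y : Matrix (Fin N) (Fin N) ℂ)))) := by
  haveI : FiniteDimensional ℝ (Matrix (Fin N) (Fin N) ℂ) := finiteDimensional_matrixC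
  set b := lieFinBasisC N Jw with hb
  set bC := Module.Basis.mk (linearIndependent_coe_basis hJ b) (span_coe_basis_eq_top hherm hJ b) with hbC
  have hM : LinearMap.toMatrix bC bC (LinearMap.mulLeftRight ℂ ((1 - (Y : Matrix (Fin N) (Fin N) ℂ)), (1 + (Y : Matrix (Fin N) (Fin N) ℂ)))) =
      (LinearMap.toMatrix b b (skewMulLC N Jw Y : skewC N Jw →ₗ[ℝ] skewC N Jw)).map (algebraMap ℝ ℂ) := by
    ext i j
    rw [Matrix.map_apply, LinearMap.toMatrix_apply, LinearMap.toMatrix_apply, hbC, basis_mk_coe_apply hherm hJ, LinearMap.mulLeftRight_apply, ← coe_skewMulLC_apply,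
      basis_mk_coe_repr_coe hherm hJ]
    rfl
  rw [← LinearMap.det_toMatrix bC, hM, ← RingHom.mapMatrix_apply, ← RingHom.map_det, LinearMap.det_toMatrix]
  rfl

/-- For `Y ∈ 𝔲(Jw)` (`Jw` hermitian invertible): `1 − Y = Jw⁻¹ (1 + Y)ᴴ Jw`, hence `det (1 − Y) = conj (det (1 + Y))`. [cite: Weyl1939, Ch. II §10] -/
theorem det_one_sub_eq_conj_det_one_add (hJ : IsUnit Jw.det) (Y : skewC N Jw) :
    (1 - (Y : Matrix (Fin N) (Fin N) ℂ)).det = conj (1 + (Y : Matrix (Fin N) (Fin N) ℂ)).det := by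
  have hY : (Y : Matrix (Fin N) (Fin N) ℂ)ᴴ * Jw = -(Jw * (Y : Matrix (Fin N) (Fin N) ℂ)) := eq_neg_of_add_eq_zero_left ((mem_skewC_iff _).1 Y.2)
  have h1 : 1 - (Y : Matrix (Fin N) (Fin N) ℂ) = Jw⁻¹ * (1 + (Y : Matrix (Fin N) (Fin N) ℂ))ᴴ * Jw := by
    rw [Matrix.conjTranspose_add, Matrix.conjTranspose_one, Matrix.mul_add, Matrix.mul_one, Matrix.add_mul, Matrix.nonsing_inv_mul _ hJ, Matrix.mul_assoc, hY,
      Matrix.mul_neg, ← Matrix.mul_assoc, Matrix.nonsing_inv_mul _ hJ, Matrix.one_mul, sub_eq_add_neg]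
  rw [h1, Matrix.det_mul, Matrix.det_mul, mul_comm (Jw⁻¹.det), mul_assoc, Matrix.det_nonsing_inv_mul_det _ hJ, mul_one, Matrix.det_conjTranspose, Complex.star_def]

/-- **THE CAYLEY WEIGHT IN CLOSED FORM**: `det_ℝ (m_Y|_𝔲(Jw)) = ‖det (1 + Y)‖^{2N}` for `Y ∈ 𝔲(Jw)`, `Jw` hermitian invertible. [cite: Weyl1939, Ch. II §10] [cite: Knapp2002, VIII §2] -/
theorem det_skewMulLC_eq (hherm : Jwᴴ = Jw) (hJ : IsUnit Jw.det) (Y : skewC N Jw) :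
    LinearMap.det (skewMulLC N Jw Y : skewC N Jw →ₗ[ℝ] skewC N Jw) = ‖(1 + (Y : Matrix (Fin N) (Fin N) ℂ)).det‖ ^ (2 * N) := by
  apply Complex.ofReal_injective
  rw [det_skewMulLC_eq_det_mulLeftRight hherm hJ Y, det_mulLeftRight, Fintype.card_fin, det_one_sub_eq_conj_det_one_add hJ Y, ← mul_pow,
    Complex.conj_mul', Complex.ofReal_pow, pow_mul]

/-- **`w₀(Y) = ‖det (1 + Y)‖^{−2N}`** (★ `cayleyWeightC` in closed form). [cite: Weyl1939, Ch. II §10] [cite: Rogawski1990, §1.7 p. 6] -/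
theorem cayleyWeightC_eq (hherm : Jwᴴ = Jw) (hJ : IsUnit Jw.det) (Y : skewC N Jw) :
    cayleyWeightC N Jw Y = (‖(1 + (Y : Matrix (Fin N) (Fin N) ℂ)).det‖ ^ (2 * N))⁻¹ := by
  rw [cayleyWeightC_def, ContinuousLinearMap.det, det_skewMulLC_eq hherm hJ Y, abs_of_nonneg (pow_nonneg (norm_nonneg _) _)]

end Weight

end UnitaryArchLocalTopForm

end Literature.NumberTheory.Weil1964

end
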